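import Literature.Geometry.Lorentzian.KerrPrincipalFrameCurvatureTable
import Literature.Geometry.Lorentzian.KerrPrincipalFrameBasis
import Literature.Geometry.Lorentzian.CoordCurvatureCubicTrace
import HarnessLib

/-!
# The cubic curvature invariant of the Kerr metric in ingoing Kerr coordinates

Infrastructure (all results proved, no definitions): the closed form of the cubic curvature
invariant `Σ g^{ii'} g^{jj'} g^{kk'} tr(R(b_i,b_j) ∘ R(b_{j'},b_k) ∘ R(b_{k'},b_{i'}))`
(`= R^{ab}{}_{cd} R^{cd}{}_{ef} R^{ef}{}_{ab}`, the index pattern of `MetricCoord.cubicTrace_pullMetric`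
and `MetricCoord.cubicTrace_eq_of_basis`) of the rational Kerr components `Kerr.Ingoing.bilin M a` in
ingoing Kerr coordinates `u = (t*, r, μ, φ)` (`KerrIngoingCoordMetric.lean`), on the regular set
`{Σ ≠ 0, μ² ≠ 1}` and for ALL real `M, a`:

  `Σ g g g tr(R R R) = 48 M³ Re (r + iaμ)⁹ / Σ⁹ = 48 (A³ − 3AB²) / Σ⁹`,
  `A + iB = M (r + iaμ)³`,  `Σ = r² + a²μ²`

(Kerr is Ricci-flat of Petrov type D with `Ψ₂ = −M/(r − iaμ)³`, Kinnersley 1969, Chandrasekhar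
1983, §58, so the invariant is `Ψ₂`-generated: Cherubini–Bini–Capozziello–Ruffini 2002, §4;
Abdelqader–Lake 2015, §III) — the hypothesis `H` of the transport lemma
`Kerr.cubicTrace_kerrBilin_of_ingoing` (`KerrCurvatureInvariantsTransport.lean`), which turns it into
the fact stub F4 `stub_factKerrCubicWeyl` of crux `TameCensorship` in the Kerr–Schild chart.

* `MetricCoord.basis_action_of_lowered` — generic linear algebra: an endomorphism acts on a basis by
  its lowered table raised with `g⁻¹`, `T b_q = Σ_p (Σ_s g^{ps} G(T b_q, b_s)) b_p`;
* `Kerr.Ingoing.pf_low4` — the six tables of `KerrPrincipalFrameCurvatureTable.lean` as ONE table of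
  `g(R(f_i,f_j) f_q, f_k)` over all ordered pairs `(i, j)` of the principal frame `(l, n, e₃, e₄)`;
* `Kerr.Ingoing.cubicTrace_frame` — the contraction computed in the principal frame: the three metric
  contractions collapse (`Kerr.Ingoing.pf_sum_ginv`), the 64 triple traces are explicit through the
  sparse frame actions (`MetricCoord.traceCLM_comp₃_eq_sum_of_basis_action`), and the result is the
  rational identity `48(A³ − 3AB²)/Σ⁹` (`Kerr.Ingoing.cubic_re_identity`);
* `Kerr.Ingoing.cubicTrace_basisFun` — the same in the coordinate basis (basis independence,
  `MetricCoord.cubicTrace_eq_of_basis`), verbatim the hypothesis of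
  `Kerr.cubicTrace_kerrBilin_of_ingoing`.

## References

* W. Kinnersley, *Type D vacuum metrics*, J. Math. Phys. 10 (1969) 1195.
* S. Chandrasekhar, *The mathematical theory of black holes* (1983), §58.
* C. Cherubini, D. Bini, S. Capozziello, R. Ruffini, *Second order scalar invariants of the Riemann
  tensor: applications to black hole spacetimes*, Int. J. Mod. Phys. D 11 (2002) 827, §4.
* M. Abdelqader, K. Lake, *Invariant characterization of the Kerr spacetime*, Phys. Rev. D 91
  (2015) 084017 (arXiv:1412.8757), §III.
* B. O'Neill, *Semi-Riemannian geometry* (1983), Ch. 3, Prop. 3.36, pp. 60–61. [ONeill1983]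
* R. P. Kerr, A. Schild (1965), §3. [KerrSchild1965]
-/

noncomputable section

set_option maxSynthPendingDepth 3

open Set Function Module
open scoped ContDiff Topology
open Literature.Geometry.Lorentzian.MetricCoord

namespace Literature.Geometry.Lorentzian

/-! ### Linear algebra: the action of an endomorphism on a basis from its lowered table -/

namespace MetricCoord

variable {E : Type*} [NormedAddCommGroup E] [NormedSpace ℝ E] [FiniteDimensional ℝ E]
  {ι : Type*} [Fintype ι] (b : Module.Basis ι ℝ E) {G : E → E →L[ℝ] E →L[ℝ] ℝ} {x : E}

/-- **An endomorphism acts on a basis through its lowered table raised by `g⁻¹`**: if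
`G(T b_q, b_k) = L[k,q]` for all `k, q` and `G x` is nondegenerate, then
`T b_q = Σ_p (Σ_s g^{ps} L[s,q]) b_p` (`bᵖ(v) = Σ_s g^{ps} G(v, b_s)`, O'Neill 1983, Ch. 3, p. 60;
`MetricCoord.coord_eq_sum_ginv`). [cite: ONeill1983, Ch. 3, pp. 60–61] -/
theorem basis_action_of_lowered (hx : (G x).IsInvertible) {T : E →L[ℝ] E} {L : ι → ι → ℝ}
    (h : ∀ k q, G x (T (b q)) (b k) = L k q) (q : ι) :
    T (b q) = ∑ p, (∑ s, ginv G b x p s * L s q) • b p := by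
  conv_lhs => rw [← b.sum_repr (T (b q))]
  refine Finset.sum_congr rfl fun p _ ↦ ?_
  rw [← b.coord_apply, coord_eq_sum_ginv b hx]
  simp only [h]

end MetricCoord

namespace Kerr

namespace Ingoing

variable (M a : ℝ) {u : E4}

/-! ### The full lowered table and the cubic invariant in the principal frame -/

/-- **All lowered frame components of the Kerr curvature tensor in one table**:
`g(R(f_i,f_j) f_q, f_k)` for all ordered pairs `(i, j)` of the principal frame `𝔣 = (l, n, e₃, e₄)`
and all `k, q` (blocks `(i, j)`; `R(f_j,f_i) = −R(f_i,f_j)`, `R(f_i,f_i) = 0`), from the six tables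
`Kerr.Ingoing.pf_low_*`: the Petrov type D pattern of Kerr, generated by `A + iB = M(r + iaμ)³`
alone (Kinnersley 1969; Chandrasekhar 1983, §58). [cite: KerrSchild1965, §3] -/
theorem pf_low4 (hu : u ∈ regularSet a) (𝔣 : Fin 4 → E4)
    (h𝔣 : ∀ i, 𝔣 i =
      ![(!₂[u 1 ^ 2 + 2 * M * u 1 + a ^ 2, u 1 ^ 2 - 2 * M * u 1 + a ^ 2, (0 : ℝ), 2 * a] : E4),
        (!₂[(1 : ℝ), -1, 0, 0] : E4), (!₂[(0 : ℝ), 0, 1 - u 2 ^ 2, 0] : E4),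
        (!₂[a * (1 - u 2 ^ 2), (0 : ℝ), 0, 1] : E4)] i) (i j k q : Fin 4) :
    bilin M a u (riemAt (bilin M a) u (𝔣 i) (𝔣 j) (𝔣 q)) (𝔣 k) =
      (![![(0 : Matrix (Fin 4) (Fin 4) ℝ),
        (!![0, -(8 * M * (u 1 ^ (3 : ℕ) - 3 * u 1 * a ^ (2 : ℕ) * u 2 ^ (2 : ℕ))) / sigma a u, 0, 0;
            8 * M * (u 1 ^ (3 : ℕ) - 3 * u 1 * a ^ (2 : ℕ) * u 2 ^ (2 : ℕ)) / sigma a u, 0, 0, 0;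
            0, 0, 0,
              4 * M * (3 * u 1 ^ (2 : ℕ) * a * u 2 - a ^ (3 : ℕ) * u 2 ^ (3 : ℕ)) * (1 - u 2 ^ (2 : ℕ)) / sigma a u;
            0, 0,
              -(4 * M * (3 * u 1 ^ (2 : ℕ) * a * u 2 - a ^ (3 : ℕ) * u 2 ^ (3 : ℕ)) * (1 - u 2 ^ (2 : ℕ))) / sigma a u,
              0] : Matrix (Fin 4) (Fin 4) ℝ),
        (!![0, 0, 0, 0;
            0, 0,
              2 * M * (u 1 ^ (3 : ℕ) - 3 * u 1 * a ^ (2 : ℕ) * u 2 ^ (2 : ℕ)) * (1 - u 2 ^ (2 : ℕ)) / sigma a u,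
              2 * M * (3 * u 1 ^ (2 : ℕ) * a * u 2 - a ^ (3 : ℕ) * u 2 ^ (3 : ℕ)) * (1 - u 2 ^ (2 : ℕ)) / sigma a u;
            0,
              -(2 * M * (u 1 ^ (3 : ℕ) - 3 * u 1 * a ^ (2 : ℕ) * u 2 ^ (2 : ℕ)) * (1 - u 2 ^ (2 : ℕ))) / sigma a u,
              0, 0;
            0,
              -(2 * M * (3 * u 1 ^ (2 : ℕ) * a * u 2 - a ^ (3 : ℕ) * u 2 ^ (3 : ℕ)) * (1 - u 2 ^ (2 : ℕ))) / sigma a u,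
              0, 0] : Matrix (Fin 4) (Fin 4) ℝ),
        (!![0, 0, 0, 0;
            0, 0,
              -(2 * M * (3 * u 1 ^ (2 : ℕ) * a * u 2 - a ^ (3 : ℕ) * u 2 ^ (3 : ℕ)) * (1 - u 2 ^ (2 : ℕ))) / sigma a u,
              2 * M * (u 1 ^ (3 : ℕ) - 3 * u 1 * a ^ (2 : ℕ) * u 2 ^ (2 : ℕ)) * (1 - u 2 ^ (2 : ℕ)) / sigma a u;
            0,
              2 * M * (3 * u 1 ^ (2 : ℕ) * a * u 2 - a ^ (3 : ℕ) * u 2 ^ (3 : ℕ)) * (1 - u 2 ^ (2 : ℕ)) / sigma a u,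
              0, 0;
            0,
              -(2 * M * (u 1 ^ (3 : ℕ) - 3 * u 1 * a ^ (2 : ℕ) * u 2 ^ (2 : ℕ)) * (1 - u 2 ^ (2 : ℕ))) / sigma a u,
              0, 0] : Matrix (Fin 4) (Fin 4) ℝ)],
      ![-(!![0, -(8 * M * (u 1 ^ (3 : ℕ) - 3 * u 1 * a ^ (2 : ℕ) * u 2 ^ (2 : ℕ))) / sigma a u, 0, 0;
            8 * M * (u 1 ^ (3 : ℕ) - 3 * u 1 * a ^ (2 : ℕ) * u 2 ^ (2 : ℕ)) / sigma a u, 0, 0, 0;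
            0, 0, 0,
              4 * M * (3 * u 1 ^ (2 : ℕ) * a * u 2 - a ^ (3 : ℕ) * u 2 ^ (3 : ℕ)) * (1 - u 2 ^ (2 : ℕ)) / sigma a u;
            0, 0,
              -(4 * M * (3 * u 1 ^ (2 : ℕ) * a * u 2 - a ^ (3 : ℕ) * u 2 ^ (3 : ℕ)) * (1 - u 2 ^ (2 : ℕ))) / sigma a u,
              0] : Matrix (Fin 4) (Fin 4) ℝ),
        (0 : Matrix (Fin 4) (Fin 4) ℝ),
        (!![0, 0,
              2 * M * (u 1 ^ (3 : ℕ) - 3 * u 1 * a ^ (2 : ℕ) * u 2 ^ (2 : ℕ)) * (1 - u 2 ^ (2 : ℕ)) / sigma a u,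
              -(2 * M * (3 * u 1 ^ (2 : ℕ) * a * u 2 - a ^ (3 : ℕ) * u 2 ^ (3 : ℕ)) * (1 - u 2 ^ (2 : ℕ))) / sigma a u;
            0, 0, 0, 0;
            -(2 * M * (u 1 ^ (3 : ℕ) - 3 * u 1 * a ^ (2 : ℕ) * u 2 ^ (2 : ℕ)) * (1 - u 2 ^ (2 : ℕ))) / sigma a u,
              0, 0, 0;
            2 * M * (3 * u 1 ^ (2 : ℕ) * a * u 2 - a ^ (3 : ℕ) * u 2 ^ (3 : ℕ)) * (1 - u 2 ^ (2 : ℕ)) / sigma a u,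
              0, 0, 0] : Matrix (Fin 4) (Fin 4) ℝ),
        (!![0, 0,
              2 * M * (3 * u 1 ^ (2 : ℕ) * a * u 2 - a ^ (3 : ℕ) * u 2 ^ (3 : ℕ)) * (1 - u 2 ^ (2 : ℕ)) / sigma a u,
              2 * M * (u 1 ^ (3 : ℕ) - 3 * u 1 * a ^ (2 : ℕ) * u 2 ^ (2 : ℕ)) * (1 - u 2 ^ (2 : ℕ)) / sigma a u;
            0, 0, 0, 0;
            -(2 * M * (3 * u 1 ^ (2 : ℕ) * a * u 2 - a ^ (3 : ℕ) * u 2 ^ (3 : ℕ)) * (1 - u 2 ^ (2 : ℕ))) / sigma a u,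
              0, 0, 0;
            -(2 * M * (u 1 ^ (3 : ℕ) - 3 * u 1 * a ^ (2 : ℕ) * u 2 ^ (2 : ℕ)) * (1 - u 2 ^ (2 : ℕ))) / sigma a u,
              0, 0, 0] : Matrix (Fin 4) (Fin 4) ℝ)],
      ![-(!![0, 0, 0, 0;
            0, 0,
              2 * M * (u 1 ^ (3 : ℕ) - 3 * u 1 * a ^ (2 : ℕ) * u 2 ^ (2 : ℕ)) * (1 - u 2 ^ (2 : ℕ)) / sigma a u,
              2 * M * (3 * u 1 ^ (2 : ℕ) * a * u 2 - a ^ (3 : ℕ) * u 2 ^ (3 : ℕ)) * (1 - u 2 ^ (2 : ℕ)) / sigma a u;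
            0,
              -(2 * M * (u 1 ^ (3 : ℕ) - 3 * u 1 * a ^ (2 : ℕ) * u 2 ^ (2 : ℕ)) * (1 - u 2 ^ (2 : ℕ))) / sigma a u,
              0, 0;
            0,
              -(2 * M * (3 * u 1 ^ (2 : ℕ) * a * u 2 - a ^ (3 : ℕ) * u 2 ^ (3 : ℕ)) * (1 - u 2 ^ (2 : ℕ))) / sigma a u,
              0, 0] : Matrix (Fin 4) (Fin 4) ℝ),
        -(!![0, 0,
              2 * M * (u 1 ^ (3 : ℕ) - 3 * u 1 * a ^ (2 : ℕ) * u 2 ^ (2 : ℕ)) * (1 - u 2 ^ (2 : ℕ)) / sigma a u,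
              -(2 * M * (3 * u 1 ^ (2 : ℕ) * a * u 2 - a ^ (3 : ℕ) * u 2 ^ (3 : ℕ)) * (1 - u 2 ^ (2 : ℕ))) / sigma a u;
            0, 0, 0, 0;
            -(2 * M * (u 1 ^ (3 : ℕ) - 3 * u 1 * a ^ (2 : ℕ) * u 2 ^ (2 : ℕ)) * (1 - u 2 ^ (2 : ℕ))) / sigma a u,
              0, 0, 0;
            2 * M * (3 * u 1 ^ (2 : ℕ) * a * u 2 - a ^ (3 : ℕ) * u 2 ^ (3 : ℕ)) * (1 - u 2 ^ (2 : ℕ)) / sigma a u,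
              0, 0, 0] : Matrix (Fin 4) (Fin 4) ℝ),
        (0 : Matrix (Fin 4) (Fin 4) ℝ),
        (!![0,
              4 * M * (3 * u 1 ^ (2 : ℕ) * a * u 2 - a ^ (3 : ℕ) * u 2 ^ (3 : ℕ)) * (1 - u 2 ^ (2 : ℕ)) / sigma a u,
              0, 0;
            -(4 * M * (3 * u 1 ^ (2 : ℕ) * a * u 2 - a ^ (3 : ℕ) * u 2 ^ (3 : ℕ)) * (1 - u 2 ^ (2 : ℕ))) / sigma a u,
              0, 0, 0;
            0, 0, 0,
              2 * M * (u 1 ^ (3 : ℕ) - 3 * u 1 * a ^ (2 : ℕ) * u 2 ^ (2 : ℕ)) * (1 - u 2 ^ (2 : ℕ)) ^ (2 : ℕ) / sigma a u;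
            0, 0,
              -(2 * M * (u 1 ^ (3 : ℕ) - 3 * u 1 * a ^ (2 : ℕ) * u 2 ^ (2 : ℕ)) * (1 - u 2 ^ (2 : ℕ)) ^ (2 : ℕ)) / sigma a u,
              0] : Matrix (Fin 4) (Fin 4) ℝ)],
      ![-(!![0, 0, 0, 0;
            0, 0,
              -(2 * M * (3 * u 1 ^ (2 : ℕ) * a * u 2 - a ^ (3 : ℕ) * u 2 ^ (3 : ℕ)) * (1 - u 2 ^ (2 : ℕ))) / sigma a u,
              2 * M * (u 1 ^ (3 : ℕ) - 3 * u 1 * a ^ (2 : ℕ) * u 2 ^ (2 : ℕ)) * (1 - u 2 ^ (2 : ℕ)) / sigma a u;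
            0,
              2 * M * (3 * u 1 ^ (2 : ℕ) * a * u 2 - a ^ (3 : ℕ) * u 2 ^ (3 : ℕ)) * (1 - u 2 ^ (2 : ℕ)) / sigma a u,
              0, 0;
            0,
              -(2 * M * (u 1 ^ (3 : ℕ) - 3 * u 1 * a ^ (2 : ℕ) * u 2 ^ (2 : ℕ)) * (1 - u 2 ^ (2 : ℕ))) / sigma a u,
              0, 0] : Matrix (Fin 4) (Fin 4) ℝ),
        -(!![0, 0,
              2 * M * (3 * u 1 ^ (2 : ℕ) * a * u 2 - a ^ (3 : ℕ) * u 2 ^ (3 : ℕ)) * (1 - u 2 ^ (2 : ℕ)) / sigma a u,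
              2 * M * (u 1 ^ (3 : ℕ) - 3 * u 1 * a ^ (2 : ℕ) * u 2 ^ (2 : ℕ)) * (1 - u 2 ^ (2 : ℕ)) / sigma a u;
            0, 0, 0, 0;
            -(2 * M * (3 * u 1 ^ (2 : ℕ) * a * u 2 - a ^ (3 : ℕ) * u 2 ^ (3 : ℕ)) * (1 - u 2 ^ (2 : ℕ))) / sigma a u,
              0, 0, 0;
            -(2 * M * (u 1 ^ (3 : ℕ) - 3 * u 1 * a ^ (2 : ℕ) * u 2 ^ (2 : ℕ)) * (1 - u 2 ^ (2 : ℕ))) / sigma a u,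
              0, 0, 0] : Matrix (Fin 4) (Fin 4) ℝ),
        -(!![0,
              4 * M * (3 * u 1 ^ (2 : ℕ) * a * u 2 - a ^ (3 : ℕ) * u 2 ^ (3 : ℕ)) * (1 - u 2 ^ (2 : ℕ)) / sigma a u,
              0, 0;
            -(4 * M * (3 * u 1 ^ (2 : ℕ) * a * u 2 - a ^ (3 : ℕ) * u 2 ^ (3 : ℕ)) * (1 - u 2 ^ (2 : ℕ))) / sigma a u,
              0, 0, 0;
            0, 0, 0,
              2 * M * (u 1 ^ (3 : ℕ) - 3 * u 1 * a ^ (2 : ℕ) * u 2 ^ (2 : ℕ)) * (1 - u 2 ^ (2 : ℕ)) ^ (2 : ℕ) / sigma a u;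
            0, 0,
              -(2 * M * (u 1 ^ (3 : ℕ) - 3 * u 1 * a ^ (2 : ℕ) * u 2 ^ (2 : ℕ)) * (1 - u 2 ^ (2 : ℕ)) ^ (2 : ℕ)) / sigma a u,
              0] : Matrix (Fin 4) (Fin 4) ℝ),
        (0 : Matrix (Fin 4) (Fin 4) ℝ)]] : Fin 4 → Fin 4 → Matrix (Fin 4) (Fin 4) ℝ) i j k q := by
  have h0 : 𝔣 0 = (!₂[u 1 ^ 2 + 2 * M * u 1 + a ^ 2, u 1 ^ 2 - 2 * M * u 1 + a ^ 2, (0 : ℝ), 2 * a] : E4) := by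
    rw [h𝔣]; rfl
  have h1 : 𝔣 1 = (!₂[(1 : ℝ), -1, 0, 0] : E4) := by rw [h𝔣]; rfl
  have h2 : 𝔣 2 = (!₂[(0 : ℝ), 0, 1 - u 2 ^ 2, 0] : E4) := by rw [h𝔣]; rfl
  have h3 : 𝔣 3 = (!₂[a * (1 - u 2 ^ 2), (0 : ℝ), 0, 1] : E4) := by rw [h𝔣]; rfl
  fin_cases i <;> fin_cases j <;>
    simp only [Fin.zero_eta, Fin.mk_one, Fin.reduceFinMk, Fin.isValue, Matrix.cons_val_zero,
      Matrix.cons_val_one, Matrix.cons_val]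
  · rw [riemAt_self, zero_apply, map_zero, zero_apply,
      Matrix.zero_apply]
  · exact pf_low_ln M a hu 𝔣 h0 h1 h2 h3 k q
  · exact pf_low_l3 M a hu 𝔣 h0 h1 h2 h3 k q
  · exact pf_low_l4 M a hu 𝔣 h0 h1 h2 h3 k q
  · rw [riemAt_swap, neg_apply, map_neg, neg_apply, pf_low_ln M a hu 𝔣 h0 h1 h2 h3 k q,
      Matrix.neg_apply]
  · rw [riemAt_self, zero_apply, map_zero, zero_apply,
      Matrix.zero_apply]
  · exact pf_low_n3 M a hu 𝔣 h0 h1 h2 h3 k q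
  · exact pf_low_n4 M a hu 𝔣 h0 h1 h2 h3 k q
  · rw [riemAt_swap, neg_apply, map_neg, neg_apply, pf_low_l3 M a hu 𝔣 h0 h1 h2 h3 k q,
      Matrix.neg_apply]
  · rw [riemAt_swap, neg_apply, map_neg, neg_apply, pf_low_n3 M a hu 𝔣 h0 h1 h2 h3 k q,
      Matrix.neg_apply]
  · rw [riemAt_self, zero_apply, map_zero, zero_apply,
      Matrix.zero_apply]
  · exact pf_low_34 M a hu 𝔣 h0 h1 h2 h3 k q
  · rw [riemAt_swap, neg_apply, map_neg, neg_apply, pf_low_l4 M a hu 𝔣 h0 h1 h2 h3 k q,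
      Matrix.neg_apply]
  · rw [riemAt_swap, neg_apply, map_neg, neg_apply, pf_low_n4 M a hu 𝔣 h0 h1 h2 h3 k q,
      Matrix.neg_apply]
  · rw [riemAt_swap, neg_apply, map_neg, neg_apply, pf_low_34 M a hu 𝔣 h0 h1 h2 h3 k q,
      Matrix.neg_apply]
  · rw [riemAt_self, zero_apply, map_zero, zero_apply,
      Matrix.zero_apply]

/-- `(MX)³ − 3(MX)(MY)² = M³ Re (r + iaμ)⁹` with `X + iY = (r + iaμ)³`: the real part of
`M³ (r + iaμ)⁹` as a polynomial. [folklore] -/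
theorem cubic_re_identity (M r a μ : ℝ) :
    (M * (r ^ 3 - 3 * r * a ^ 2 * μ ^ 2)) ^ 3 -
        3 * (M * (r ^ 3 - 3 * r * a ^ 2 * μ ^ 2)) * (M * (3 * r ^ 2 * a * μ - a ^ 3 * μ ^ 3)) ^ 2 =
      M ^ 3 * (r ^ 9 - 36 * r ^ 7 * (a * μ) ^ 2 + 126 * r ^ 5 * (a * μ) ^ 4 - 84 * r ^ 3 * (a * μ) ^ 6 +
        9 * r * (a * μ) ^ 8) := by
  ring

-- The next proof expands the three collapsed contractions (64 terms) and the 64 triple traces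
-- through the sparse frame actions before one rational identity; the `simp only` expansions need
-- a little more than the default budget.
set_option maxHeartbeats 400000 in
/-- **The cubic curvature invariant of Kerr in its principal frame** (ingoing Kerr coordinates,
regular set `{Σ ≠ 0, μ² ≠ 1}`, all real `M, a`): for the rational principal frame
`𝔣 = (l, n, e₃, e₄)` (`Kerr.Ingoing.exists_frameBasis`),
`Σ g^{ii'}g^{jj'}g^{kk'} tr(R(f_i,f_j) R(f_{j'},f_k) R(f_{k'},f_{i'})) = 48 M³ Re(r + iaμ)⁹/Σ⁹`
(`= 48(A³ − 3AB²)/Σ⁹`, `A + iB = M(r + iaμ)³`; Petrov type D). [cite: KerrSchild1965, §3] -/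
theorem cubicTrace_frame (hu : u ∈ regularSet a) (𝔣 : Module.Basis (Fin 4) ℝ E4)
    (h𝔣 : ∀ i, 𝔣 i =
      ![(!₂[u 1 ^ 2 + 2 * M * u 1 + a ^ 2, u 1 ^ 2 - 2 * M * u 1 + a ^ 2, (0 : ℝ), 2 * a] : E4),
        (!₂[(1 : ℝ), -1, 0, 0] : E4), (!₂[(0 : ℝ), 0, 1 - u 2 ^ 2, 0] : E4),
        (!₂[a * (1 - u 2 ^ 2), (0 : ℝ), 0, 1] : E4)] i) :
    ∑ i, ∑ i', ∑ j, ∑ j', ∑ k, ∑ k',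
        ginv (bilin M a) 𝔣 u i i' * ginv (bilin M a) 𝔣 u j j' * ginv (bilin M a) 𝔣 u k k' *
        traceCLM E4 ((riemAt (bilin M a) u (𝔣 i) (𝔣 j)).comp
          ((riemAt (bilin M a) u (𝔣 j') (𝔣 k)).comp (riemAt (bilin M a) u (𝔣 k') (𝔣 i')))) =
      48 * M ^ 3 * (u 1 ^ 9 - 36 * u 1 ^ 7 * (a * u 2) ^ 2 + 126 * u 1 ^ 5 * (a * u 2) ^ 4 -
        84 * u 1 ^ 3 * (a * u 2) ^ 6 + 9 * u 1 * (a * u 2) ^ 8) / (u 1 ^ 2 + (a * u 2) ^ 2) ^ 9 := by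
  have hS := hu.1
  have hP : (1 : ℝ) - u 2 ^ 2 ≠ 0 := hu.2
  have hlow := pf_low4 M a hu 𝔣 h𝔣
  have hact := fun i j ↦ basis_action_of_lowered 𝔣 (isInvertible_bilin M a hu) (hlow i j)
  have htr := fun i j i' j' i'' j'' ↦
    traceCLM_comp₃_eq_sum_of_basis_action 𝔣 (hact i j) (hact i' j') (hact i'' j'')
  rw [cubicTrace_eq_nested]
  -- the three metric contractions collapse in the frame (`g⁻¹` pairs `l ↔ n`, `e₃`, `e₄`)
  simp only [pf_sum_ginv M a hu 𝔣 h𝔣]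
  simp only [Fin.sum_univ_four, Fin.isValue, Matrix.cons_val_zero, Matrix.cons_val_one,
    Matrix.cons_val]
  -- the 64 triple traces through the sparse frame actions
  simp only [htr]
  simp (maxSteps := 4000000) only [Fin.isValue, Matrix.cons_val_zero, Matrix.cons_val_one,
    Matrix.cons_val, Matrix.of_apply, Matrix.neg_apply, Matrix.zero_apply, mul_zero, zero_mul,
    Finset.sum_const_zero, pf_sum_ginv M a hu 𝔣 h𝔣]
  simp (maxSteps := 4000000) only [Fin.sum_univ_four, Fin.isValue, Matrix.cons_val_zero,
    Matrix.cons_val_one, Matrix.cons_val, mul_zero, zero_mul, neg_zero, add_zero, zero_add, mul_neg,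
    neg_mul, neg_neg]
  -- the rational identity `48(A³ − 3AB²)/Σ⁹ = 48 M³ Re(r + iaμ)⁹/Σ⁹` (`A = MX`, `B = MY`)
  have hσ : u 1 ^ 2 + (a * u 2) ^ 2 = sigma a u := by rw [sigma]; ring
  conv_rhs => rw [hσ, mul_assoc, ← cubic_re_identity M (u 1) a (u 2)]
  generalize (u 1 ^ 3 - 3 * u 1 * a ^ 2 * u 2 ^ 2 : ℝ) = X
  generalize (3 * u 1 ^ 2 * a * u 2 - a ^ 3 * u 2 ^ 3 : ℝ) = Y
  simp only [sinSq]
  field_simp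
  ring

/-- **The cubic curvature invariant of Kerr in ingoing Kerr coordinates** (coordinate basis): on
the regular set, `Σ g^{ii'}g^{jj'}g^{kk'} tr(R(∂_i,∂_j) R(∂_{j'},∂_k) R(∂_{k'},∂_{i'})) =
48 M³ Re(r + iaμ)⁹/Σ⁹ = 48 M³ (r⁹ − 36r⁷s² + 126r⁵s⁴ − 84r³s⁶ + 9rs⁸)/(r² + s²)⁹`, `s = aμ`, for the
rational components `Kerr.Ingoing.bilin M a` and all real `M, a` — verbatim the hypothesis of
`Kerr.cubicTrace_kerrBilin_of_ingoing` (Cherubini–Bini–Capozziello–Ruffini 2002, §4); from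
`cubicTrace_frame` by basis independence (`MetricCoord.cubicTrace_eq_of_basis`).
[cite: KerrSchild1965, §3] -/
theorem cubicTrace_basisFun (hu : u ∈ regularSet a) :
    ∑ i, ∑ i', ∑ j, ∑ j', ∑ k, ∑ k',
        ginv (bilin M a) (EuclideanSpace.basisFun (Fin 4) ℝ).toBasis u i i' *
        ginv (bilin M a) (EuclideanSpace.basisFun (Fin 4) ℝ).toBasis u j j' *
        ginv (bilin M a) (EuclideanSpace.basisFun (Fin 4) ℝ).toBasis u k k' *
        traceCLM E4 ((riemAt (bilin M a) u (E4.basisVector i) (E4.basisVector j)).comp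
          ((riemAt (bilin M a) u (E4.basisVector j') (E4.basisVector k)).comp
            (riemAt (bilin M a) u (E4.basisVector k') (E4.basisVector i')))) =
      48 * M ^ 3 * (u 1 ^ 9 - 36 * u 1 ^ 7 * (a * u 2) ^ 2 + 126 * u 1 ^ 5 * (a * u 2) ^ 4 -
        84 * u 1 ^ 3 * (a * u 2) ^ 6 + 9 * u 1 * (a * u 2) ^ 8) / (u 1 ^ 2 + (a * u 2) ^ 2) ^ 9 := by
  obtain ⟨𝔣, h𝔣⟩ := exists_frameBasis M a hu
  rw [← cubicTrace_frame M a hu 𝔣 h𝔣,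
    cubicTrace_eq_of_basis (bilin M a) 𝔣 (EuclideanSpace.basisFun (Fin 4) ℝ).toBasis u]
  simp only [basisFun_toBasis_apply]

end Ingoing

end Kerr

end Literature.Geometry.Lorentzian

end
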